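import Literature.MathematicalPhysics.QuantumFieldTheory.Balaban1983to89.B4Sect3BlockAveraging
import Literature.MathematicalPhysics.QuantumFieldTheory.Balaban1983to89.B4Prop23Sect3Route
import Literature.MathematicalPhysics.QuantumFieldTheory.Balaban1983to89.B4Ineq115Sect3Route
import Literature.MathematicalPhysics.QuantumFieldTheory.Balaban1983to89.B4Ineq310Proof
import Literature.MathematicalPhysics.QuantumFieldTheory.Balaban1983to89.B4Prop23Sect5Route

/-!
# `Balaban1983to89.B4Prop23BlockAvg` — T. Bałaban, *Regularity and decay of lattice Green's functions*, Commun. Math.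
# Phys. **89** (1983) 571–597 [Balaban1983RegularityDecay], Sect. 3 pp. 586–589: «Proposition 2.3 of [1]» (1.15),
# (1.16), (1.18) FOR THE LATTICE BLOCK AVERAGING — the §3 route assembled, with every structural hypothesis of the
# plain-matrix dictionary DISCHARGED and only the analytic inputs (positivity (1.8), Corollary 2.3 / the `L²` bound for
# the two-scale propagator `G_k(Ω,Λ,A)`) left as explicit binders

statement-level skeleton of published theorems with citation tags; proofs where landed; nothing here is a claim about the Yang–Mills mass gap

PDF held: `paper:balaban1983-cmp89-regularity-decay` (journal page = PDF page + 570); renders `…-p004-x2.png` (Prop. 2.3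
of [1]), `…-p017-x2.png`–`…-p019-x2.png` (§3) read as images.

CITATION HEADER (lean-in-tree rule).  lit-balaban cell (HOME `run/shared/lean/pub/lit-balaban/`), unit `lit-balaban-r01`
(reader/typer of CMP 89 = block B4, paper fold owner; gen 3), SKELETON row `B4.Prop2.3[I]` (`B4.Prop23Printed`, the
abstract `UnitSetting` statement — typed-existing, proved at `A = 0` in `B4Prop23ZeroBox`/`B4Prop23ZeroRegion`; NOT the
target here).  This module COMPOSES, by name and without re-proving anything: `B4GaussRep36Proof.rep36` ((3.6), proved),
`B4Ineq310Proof.ineq310` ((3.10), proved from Corollary 2.3-shape inputs), `B4Sect3BlockAveraging` (structure of the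
averaging matrices `B4GaugeCovariance.avgOp`: `RowOrtho`, `BlockCompatible`, supports and norms of the (3.8) functions,
Löwner domination), `B4Prop23Sect3Route` ((1.16)/(1.18) from (3.8)/(3.10)) and `B4Ineq115Sect3Route` ((1.15)); v1.1 also
`B4Prop23Sect5Route` (the §5 route, pp. 593–594).

THE MODEL (p. 572 (1.4), p. 587 (3.2), p. 574): sites of the `η`-lattice `X` (times the colour index `ι`), unit-lattice
points `Y`, `L`-lattice points `Z`; the unit blocks `B^k(y) = blk⁻¹(y)` (`n_k` sites each) and the `L`-blocks `B(z) =
Blk⁻¹(z)` (`n = L^d` points each); `Q_k(A) = avgOp qk Tk` with weights `c·1[x ∈ B^k(y)]` (`c = η^d`) and orthogonal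
transporters `U(A(Γ^{(k)}_{y,x}))`, `Q(A) = avgOp q T` with weights `n⁻¹·1[y ∈ B(z)]` and orthogonal `U(A(Γ_{z,y}))`;
`Λ = ⋃_{z∈S′}B(z)` («Λ being a sum of big blocks»), `B^k(Λ)` / `B^k(Λ^c)` = the sites whose `L`-block label is / is not in
`S′`; `S_y = B^{k+1}(z(y))` = the sites with the same `L`-block label as `y`.

WHAT IS PROVED (kernel, zero `sorry`; remaining hypotheses = the printed analytic inputs only):
* `abs_cLam_le_blockAvg` — **(1.16)** (support form): positivity (1.8) of the form (3.5) + Corollary 2.3 (2.30) for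
  `G_k(Ω,Λ,A)` (`hG`, census G-B4-04) ⇒ `|C^{(k)}_Λ(Ω,A;y,y′)| ≤ cκc²n_k·e^{−δ·dist(B^{k+1}(z(y)),B^{k+1}(z(y′)))} +
  (a_{k+1}L^{−2}/a_k²)|P(A;y,y′)| + δ_{yy′}/a_k`; `abs_cLam_le_exp_blockAvg` — (1.16) AS PRINTED, `≤ c₁e^{−δ|y−y′|}`, under
  the block-diameter hypotheses relating `|y−y′|` to the block distances (`hρS`, `hρP`, `hρ0`);
* `abs_deltaC_le_blockAvg` — **(1.18)** (support form): positivity of both forms + Corollary 2.3 for `G_k(Ω,Λ,A)` and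
  `G^η_{k+1}(Ω,A)` + the bound `v` of the perturbation (3.9) ⇒ via the PROVED (3.10) (`B4Ineq310Proof.ineq310`, its `hR`
  discharged by `avgOp_row_support_compl`) `|δC^{(k)}_Λ(Ω,A;y,y′)| ≤ c₀κc²n_k·exp[−(δ/2)(dist(S_y,S_{y′}) +
  dist(S_y,B^k(Λ^c)) + dist(S_{y′},B^k(Λ^c)))]`, `c₀ = max{2c, v(κc)²}`; `abs_deltaC_le_exp_blockAvg` — (1.18) AS PRINTED;
* `abs_deltaC_region_le_blockAvg` — the **(1.20)** step in the same currency (two background operators `H`, `H₀` on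
  the common site set; the second member of (2.30) for their two-scale propagators as input);
* `form115_blockAvg` — **(1.15)** both bounds on `L²(Ω^{(k)})`: `(c′c²n_k + a_k⁻¹)⁻¹|v|² ≤ ⟨v,(Δ^{(k)}(Ω,A) +
  aL^{−2}P(A))v⟩ ≤ (a_k + aL^{−2})|v|²` from positivity (1.8) and the `L²` bound `G^η_{k+1}(Ω,A) ≤ c′` ((2.28)-shape);
* `abs_pOp_le_one` — `|P(A;y,y′)| ≤ 1` for the projection `P = L^dQᵀQ`.
* (v1.1, §4) `prop23_116_118_blockAvg_sect5` — **(1.16) and (1.17)–(1.18) for EVERY `Λ ⊆ Ω^{(k)}`** (no "sum of big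
  blocks" restriction) for the same block-averaging data, by the combined §3 ∧ §5 route of pp. 588–589 / 593–594
  (`B4Prop23Sect5Route.prop23_116_118_of_cor23_rep36`: (1.15)-lower ⇒ (5.3), Corollary 2.3 ⇒ (5.4), the kernel-proved
  Sect. 5 Theorem), modulo ONE-scale inputs only: positivity (1.8) at `Λ = Ω^{(k)}`, the `L²` bound for `G^η_{k+1}(Ω,A)`,
  Corollary 2.3 (2.30) for `G_k(Ω,A)`, symmetry of `H`, a lattice-sum profile of the unit lattice and the block geometry;
  `avgOp_row_sq_le` (rows of `Q_k` have square norm `c²n_k`).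
* (v1.2, §5) `prop23_120_blockAvg_sect5` — **(1.19)–(1.20) for EVERY `Λ ⊆ Ω^{(k)}`** for the same block-averaging data
  and two regions `Ω ⊂ Ω₀` (two form matrices `H`, `H₀` on the common site set), by the §5 route
  (`B4Prop23Sect5Route.prop23_120_of_cor23_rep36`: (1.15)-lower ⇒ (5.3) for both operators, Corollary 2.3 ⇒ (5.4) for
  both, the Theorem (1.11)–(1.12) ⇒ (5.5) = (5.9), conclusion (5.10) of the kernel-proved Sect. 5 Theorem), modulo
  ONE-scale inputs only: positivity (1.8) at `Λ = Ω^{(k)}` and the `L²` bound of `G^η_{k+1}` for both operators,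
  Corollary 2.3 (2.30) for `G_k(Ω,A)`, `G_k(Ω₀,A)`, the Theorem (1.11)–(1.12) for `δG_k(Ω,Ω₀,A)`, symmetry, the
  lattice-sum profile, the block geometry and an admissible boundary weight `ω` (`dist(·,Ω^{(k)c})`).
No definition is introduced; nothing of the paper beyond these implications is asserted (in particular Corollary 2.3
for the two-scale propagator, asserted in print "with only slight changes", remains an input).
-/

namespace Literature.MathematicalPhysics.QuantumFieldTheory.Balaban1983to89.B4Prop23BlockAvg

open Matrix Finset B4GaussRep36 B4GaugeCovariance B4Sect3BlockAveraging B4Prop23Sect3Route B4Ineq115Sect3Route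

variable {X Y Z ι : Type*}

/-! ## §0. The projection entries and the support sets -/

/-- `|P(A;y,y′)| ≤ 1` for the orthogonal projection `P = wQᵀQ` (`RowOrtho`): `P(y,y′)² ≤ Σ_z P(y,z)² = P(y,y) ≤ 1`.
[cite: Balaban1983RegularityDecay, (1.5) p.572, (3.6) p.588] -/
theorem abs_pOp_le_one [Fintype Y] [Fintype Z] [DecidableEq Z] {w : ℝ} {Q : Matrix Z Y ℝ} (hQ : RowOrtho w Q)
    (hw : w ≠ 0) (y y' : Y) : |pOp w Q y y'| ≤ 1 := by
  have hPP := pOp_mul_pOp hQ hw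
  have hPt := pOp_transpose w Q
  have hsym : ∀ i j, pOp w Q i j = pOp w Q j i := fun i j => by
    simpa [Matrix.transpose_apply] using congrFun (congrFun hPt j) i
  have hdiag : pOp w Q y y = ∑ z, pOp w Q y z ^ 2 := by
    have h := congrFun (congrFun hPP y) y
    rw [Matrix.mul_apply] at h
    rw [← h]
    exact Finset.sum_congr rfl fun z _ => by rw [sq, hsym z y]
  have h1 : pOp w Q y y' ^ 2 ≤ ∑ z, pOp w Q y z ^ 2 :=
    Finset.single_le_sum (fun z _ => sq_nonneg (pOp w Q y z)) (Finset.mem_univ y')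
  have h2 : pOp w Q y y ^ 2 ≤ ∑ z, pOp w Q y z ^ 2 :=
    Finset.single_le_sum (fun z _ => sq_nonneg (pOp w Q y z)) (Finset.mem_univ y)
  rw [← hdiag] at h1 h2
  have h3 : pOp w Q y y ≤ 1 := by nlinarith
  exact (sq_le_one_iff_abs_le_one _).mp (h1.trans h3)

/-- SUPPORT of the functions (3.8) in the model: `supp t_y ⊆ S_y = B^{k+1}(z(y))` (the sites with the `L`-block label of
`y`) — `B4Sect3BlockAveraging.tOp_apply_ne_zero` as a support statement. [cite: Balaban1983RegularityDecay, (3.7)–(3.8) p.588] -/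
theorem tOp_support_blockAvg [Fintype X] [Fintype Y] [Fintype Z] [Fintype ι] [DecidableEq Z] [DecidableEq ι]
    {blk : X → Y} {Blk : Y → Z} {qk : Y → X → ℝ} {q : Z → Y → ℝ} (hqk : ∀ y x, blk x ≠ y → qk y x = 0)
    (hq : ∀ z y, Blk y ≠ z → q z y = 0) (Tk : Y → X → Matrix ι ι ℝ) (T : Z → Y → Matrix ι ι ℝ) (ak a ℓ w : ℝ)
    (Λ : Finset (Y × ι)) (Λ' : Finset (Z × ι)) (p : Λ) (r : X × ι)
    (hr : r ∉ univ.filter fun r : X × ι => Blk (blk r.1) = Blk p.1.1) :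
    tOp ak (avgOp qk Tk) a ℓ w (avgOp q T) Λ Λ' p r = 0 := by
  by_contra h
  exact hr (Finset.mem_filter.mpr ⟨Finset.mem_univ _, tOp_apply_ne_zero hqk hq Tk T ak a ℓ w Λ Λ' h⟩)

/-- `S_y = B^{k+1}(z(y)) ⊆ B^k(Λ)` for `y ∈ Λ` («Λ being a sum of big blocks»). [cite: Balaban1983RegularityDecay, (3.7) p.588, (3.10) p.589] -/
theorem blockOf_subset_bkΛ [Fintype X] [Fintype ι] [DecidableEq Z] {blk : X → Y} {Blk : Y → Z} {S' : Finset Z}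
    {Λ : Finset (Y × ι)} (hΛ : ∀ p, p ∈ Λ ↔ Blk p.1 ∈ S') (p : Λ) :
    (univ.filter fun r : X × ι => Blk (blk r.1) = Blk p.1.1) ⊆
      univ.filter fun r : X × ι => Blk (blk r.1) ∈ S' := by
  intro r hr
  rw [Finset.mem_filter] at hr ⊢
  refine ⟨hr.1, ?_⟩
  rw [hr.2]
  exact (hΛ p.1).mp p.2

/-! ## §1. (1.16) for the block averaging -/

/-- **(1.16) FOR THE LATTICE BLOCK AVERAGING, support form**: for `Q_k(A)`, `Q(A)` the block-averaging operators
(1.4)/(3.2) (block weights `c`, `L^{−d} = n⁻¹`; orthogonal transporters), `Λ` a union of `L`-blocks, `a_k, a, L^{−2} >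
0`, the two-scale form (3.5) positive definite ((1.8)) and the Corollary 2.3 decay (2.30) of `G_k(Ω,Λ,A)` (`hG` — the
INPUT, asserted for the two-scale propagator *"with only slight changes"*, census G-B4-04):  `|C^{(k)}_Λ(Ω,A;y,y′)| ≤
cκ(c²n_k)·e^{−δ·dist(S_y,S_{y′})} + (a_{k+1}L^{−2}/a_k²)|P(A;y,y′)| + δ_{yy′}/a_k`, `S_y = B^{k+1}(z(y))`.  Everything else
((3.6), supports and norms of (3.8), `RowOrtho`, `BlockCompatible`) is discharged. [cite: Balaban1983RegularityDecay, Prop. 2.3 of [1] (1.16) p.574, (3.8) p.588] -/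
theorem abs_cLam_le_blockAvg [Fintype X] [Fintype Y] [Fintype Z] [Fintype ι] [DecidableEq X] [DecidableEq Y]
    [DecidableEq Z] [DecidableEq ι] {blk : X → Y} {Blk : Y → Z} {qk : Y → X → ℝ} {q : Z → Y → ℝ}
    (Tk : Y → X → Matrix ι ι ℝ) (T : Z → Y → Matrix ι ι ℝ) {c : ℝ} {nk n : ℕ}
    (hqk : ∀ y x, blk x ≠ y → qk y x = 0) (hqkc : ∀ x, qk (blk x) x = c)
    (hcardk : ∀ y, (univ.filter fun x => blk x = y).card = nk) (hTk : ∀ x, Tk (blk x) x * (Tk (blk x) x)ᵀ = 1)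
    (hq : ∀ z y, Blk y ≠ z → q z y = 0) (hqc : ∀ y, q (Blk y) y = (n : ℝ)⁻¹)
    (hcard : ∀ z, (univ.filter fun y => Blk y = z).card = n) (hT : ∀ y, T (Blk y) y * (T (Blk y) y)ᵀ = 1)
    (hn : 0 < n) {S' : Finset Z} {Λ : Finset (Y × ι)} {Λ' : Finset (Z × ι)} (hΛ : ∀ p, p ∈ Λ ↔ Blk p.1 ∈ S')
    (hΛ' : ∀ r, r ∈ Λ' ↔ r.1 ∈ S') (H : Matrix (X × ι) (X × ι) ℝ) {ak a ℓ : ℝ} (hak : 0 < ak) (ha : 0 < a)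
    (hℓ : 0 < ℓ) (hKΛ : (kLam H ak (avgOp qk Tk) a ℓ (n : ℝ) (avgOp q T) Λ Λ').PosDef)
    {nrm : (X × ι → ℝ) → ℝ} {sdist : Finset (X × ι) → Finset (X × ι) → ℝ} {κ cc δ : ℝ}
    (hn2 : ∀ u, nrm u ^ 2 = κ * (u ⬝ᵥ u)) (hκ : 0 ≤ κ) (hcc : 0 ≤ cc)
    (hG : ∀ (g g' : X × ι → ℝ) (U U' : Finset (X × ι)), (∀ x ∉ U, g x = 0) → (∀ x ∉ U', g' x = 0) →
      |g ⬝ᵥ (gLam H ak (avgOp qk Tk) a ℓ (n : ℝ) (avgOp q T) Λ Λ' *ᵥ g')| ≤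
        cc * nrm g * nrm g' * Real.exp (-(δ * sdist U U')))
    (y y' : Λ) :
    |cLam H ak (avgOp qk Tk) a ℓ (n : ℝ) (avgOp q T) Λ y y'| ≤
      cc * (κ * (c ^ 2 * nk)) *
          Real.exp (-(δ * sdist (univ.filter fun r : X × ι => Blk (blk r.1) = Blk y.1.1)
            (univ.filter fun r : X × ι => Blk (blk r.1) = Blk y'.1.1))) +
        aNext a ak ℓ * ℓ / ak ^ 2 * |pOp (n : ℝ) (avgOp q T) y y'| + (if y = y' then 1 / ak else 0) := by
  have hnpos : (0 : ℝ) < n := by exact_mod_cast hn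
  have hRO := rowOrtho_avgOp Blk q T n hq hqc hcard hT
  have hB := blockCompatible_avgOp hq T hΛ hΛ'
  have h36 := rep36_of_kLam_posDef H (avgOp qk Tk) hak ha hℓ hnpos hRO hB hKΛ
  have hQk := avgOp_mul_transpose blk qk Tk c nk hqk hqkc hcardk hTk
  have hck : (0 : ℝ) ≤ c ^ 2 * nk := by positivity
  have hT' := fun p : Λ => tOp_row_sq_le hak ha.le hℓ.le hnpos hRO hQk hck Λ Λ' p
  have hθ : 0 ≤ aNext a ak ℓ * ℓ := by rw [aNext]; positivity
  exact abs_cLam_le (fun p : Λ => univ.filter fun r : X × ι => Blk (blk r.1) = Blk p.1.1) h36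
    (fun p r hr => tOp_support_blockAvg hqk hq Tk T ak a ℓ (n : ℝ) Λ Λ' p r hr) hT' hn2 hκ hcc hak hθ hG y y'

/-- **(1.16) FOR THE LATTICE BLOCK AVERAGING, AS PRINTED** (point form `≤ c₁e^{−δ|y−y′|}`): under the additional
block-diameter hypotheses on the unit-lattice distance `udist` (`|y−y′| ≤ dist(S_y,S_{y′}) + ρ`; `P(A;y,y′) ≠ 0 ⇒
|y−y′| ≤ ρ`; `|y−y| ≤ ρ`; `δ ≥ 0`), `|C^{(k)}_Λ(Ω,A;y,y′)| ≤ (cκc²n_k + a_{k+1}L^{−2}/a_k² + a_k⁻¹)e^{δρ}·e^{−δ|y−y′|}` —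
*"|C^{(k)}_Λ(Ω,A; x,x′)| ≤ c₀ exp(−δ₀|x−x′|), x, x′ ∈ Λ. (1.16)"*; `|P(A;y,y′)| ≤ 1` is discharged (`abs_pOp_le_one`).
[cite: Balaban1983RegularityDecay, Prop. 2.3 of [1] (1.16) p.574, (3.8) p.588] -/
theorem abs_cLam_le_exp_blockAvg [Fintype X] [Fintype Y] [Fintype Z] [Fintype ι] [DecidableEq X] [DecidableEq Y]
    [DecidableEq Z] [DecidableEq ι] {blk : X → Y} {Blk : Y → Z} {qk : Y → X → ℝ} {q : Z → Y → ℝ}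
    (Tk : Y → X → Matrix ι ι ℝ) (T : Z → Y → Matrix ι ι ℝ) {c : ℝ} {nk n : ℕ}
    (hqk : ∀ y x, blk x ≠ y → qk y x = 0) (hqkc : ∀ x, qk (blk x) x = c)
    (hcardk : ∀ y, (univ.filter fun x => blk x = y).card = nk) (hTk : ∀ x, Tk (blk x) x * (Tk (blk x) x)ᵀ = 1)
    (hq : ∀ z y, Blk y ≠ z → q z y = 0) (hqc : ∀ y, q (Blk y) y = (n : ℝ)⁻¹)
    (hcard : ∀ z, (univ.filter fun y => Blk y = z).card = n) (hT : ∀ y, T (Blk y) y * (T (Blk y) y)ᵀ = 1)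
    (hn : 0 < n) {S' : Finset Z} {Λ : Finset (Y × ι)} {Λ' : Finset (Z × ι)} (hΛ : ∀ p, p ∈ Λ ↔ Blk p.1 ∈ S')
    (hΛ' : ∀ r, r ∈ Λ' ↔ r.1 ∈ S') (H : Matrix (X × ι) (X × ι) ℝ) {ak a ℓ : ℝ} (hak : 0 < ak) (ha : 0 < a)
    (hℓ : 0 < ℓ) (hKΛ : (kLam H ak (avgOp qk Tk) a ℓ (n : ℝ) (avgOp q T) Λ Λ').PosDef)
    {nrm : (X × ι → ℝ) → ℝ} {sdist : Finset (X × ι) → Finset (X × ι) → ℝ} {κ cc δ : ℝ}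
    (hn2 : ∀ u, nrm u ^ 2 = κ * (u ⬝ᵥ u)) (hκ : 0 ≤ κ) (hcc : 0 ≤ cc)
    (hG : ∀ (g g' : X × ι → ℝ) (U U' : Finset (X × ι)), (∀ x ∉ U, g x = 0) → (∀ x ∉ U', g' x = 0) →
      |g ⬝ᵥ (gLam H ak (avgOp qk Tk) a ℓ (n : ℝ) (avgOp q T) Λ Λ' *ᵥ g')| ≤
        cc * nrm g * nrm g' * Real.exp (-(δ * sdist U U')))
    {udist : (Y × ι) → (Y × ι) → ℝ} {ρ : ℝ} (hδ : 0 ≤ δ)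
    (hρS : ∀ p p' : Λ, udist p p' ≤ sdist (univ.filter fun r : X × ι => Blk (blk r.1) = Blk p.1.1)
      (univ.filter fun r : X × ι => Blk (blk r.1) = Blk p'.1.1) + ρ)
    (hρP : ∀ p p' : Λ, pOp (n : ℝ) (avgOp q T) p p' ≠ 0 → udist p p' ≤ ρ) (hρ0 : ∀ p : Λ, udist p p ≤ ρ)
    (y y' : Λ) :
    |cLam H ak (avgOp qk Tk) a ℓ (n : ℝ) (avgOp q T) Λ y y'| ≤
      (cc * (κ * (c ^ 2 * nk)) + aNext a ak ℓ * ℓ / ak ^ 2 + 1 / ak) * Real.exp (δ * ρ) *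
        Real.exp (-(δ * udist y y')) := by
  have hnpos : (0 : ℝ) < n := by exact_mod_cast hn
  have hRO := rowOrtho_avgOp Blk q T n hq hqc hcard hT
  have hB := blockCompatible_avgOp hq T hΛ hΛ'
  have h36 := rep36_of_kLam_posDef H (avgOp qk Tk) hak ha hℓ hnpos hRO hB hKΛ
  have hQk := avgOp_mul_transpose blk qk Tk c nk hqk hqkc hcardk hTk
  have hck : (0 : ℝ) ≤ c ^ 2 * nk := by positivity
  have hT' := fun p : Λ => tOp_row_sq_le hak ha.le hℓ.le hnpos hRO hQk hck Λ Λ' p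
  have hθ : 0 ≤ aNext a ak ℓ * ℓ := by rw [aNext]; positivity
  exact abs_cLam_le_exp (fun p : Λ => univ.filter fun r : X × ι => Blk (blk r.1) = Blk p.1.1) h36
    (fun p r hr => tOp_support_blockAvg hqk hq Tk T ak a ℓ (n : ℝ) Λ Λ' p r hr) hT' hn2 hκ hcc hck hak hθ hG hδ
    hρS hρP hρ0 (fun p p' => abs_pOp_le_one hRO hnpos.ne' p p') y y'

/-! ## §2. (1.18) for the block averaging, through the proved (3.10) -/

/-- **(1.18) FOR THE LATTICE BLOCK AVERAGING, support form**: block-averaging `Q_k(A)`, `Q(A)` as above, `Λ` a union of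
`L`-blocks, both forms of (3.5) positive definite ((1.8), for `Λ` and for `Λ = Ω^{(k)}`), the Corollary 2.3 decay (2.30)
of BOTH `G_k(Ω,Λ,A)` and `G^η_{k+1}(Ω,A)` with constants `(c, δ)` and the bound `v` of the perturbation `[a_kP_k −
a_{k+1}L^{−2}P_{k+1}](Ω∖B^k(Λ))` (the inputs of (3.10), exactly the binders of `B4Ineq310Proof.ineq310`; its support
hypothesis `hR` and `BlockCompatible` are discharged here) ⇒ `|δC^{(k)}_Λ(Ω,A;y,y′)| ≤ c₀κ(c²n_k)·exp[−(δ/2)(dist(S_y,S_{y′})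
+ dist(S_y,B^k(Λ^c)) + dist(S_{y′},B^k(Λ^c)))]`, `c₀ = max{2c, v(κc)²}` — *"the inequality (3.10) implies (1.18)"* (p. 589).
[cite: Balaban1983RegularityDecay, Prop. 2.3 of [1] (1.18) p.574, (3.10) p.589] -/
theorem abs_deltaC_le_blockAvg [Fintype X] [Fintype Y] [Fintype Z] [Fintype ι] [DecidableEq X] [DecidableEq Y]
    [DecidableEq Z] [DecidableEq ι] {blk : X → Y} {Blk : Y → Z} {qk : Y → X → ℝ} {q : Z → Y → ℝ}
    (Tk : Y → X → Matrix ι ι ℝ) (T : Z → Y → Matrix ι ι ℝ) {c : ℝ} {nk n : ℕ}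
    (hqk : ∀ y x, blk x ≠ y → qk y x = 0) (hqkc : ∀ x, qk (blk x) x = c)
    (hcardk : ∀ y, (univ.filter fun x => blk x = y).card = nk) (hTk : ∀ x, Tk (blk x) x * (Tk (blk x) x)ᵀ = 1)
    (hq : ∀ z y, Blk y ≠ z → q z y = 0) (hqc : ∀ y, q (Blk y) y = (n : ℝ)⁻¹)
    (hcard : ∀ z, (univ.filter fun y => Blk y = z).card = n) (hT : ∀ y, T (Blk y) y * (T (Blk y) y)ᵀ = 1)
    (hn : 0 < n) {S' : Finset Z} {Λ : Finset (Y × ι)} {Λ' : Finset (Z × ι)} (hΛ : ∀ p, p ∈ Λ ↔ Blk p.1 ∈ S')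
    (hΛ' : ∀ r, r ∈ Λ' ↔ r.1 ∈ S') (H : Matrix (X × ι) (X × ι) ℝ) {ak a ℓ : ℝ} (hak : 0 < ak) (ha : 0 < a)
    (hℓ : 0 < ℓ) (hKΛ : (kLam H ak (avgOp qk Tk) a ℓ (n : ℝ) (avgOp q T) Λ Λ').PosDef)
    (hKU : (kLam H ak (avgOp qk Tk) a ℓ (n : ℝ) (avgOp q T) Finset.univ Finset.univ).PosDef)
    {nrm : (X × ι → ℝ) → ℝ} {sdist : Finset (X × ι) → Finset (X × ι) → ℝ} {κ cc δ v : ℝ}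
    (hn0 : ∀ u, 0 ≤ nrm u) (hn2 : ∀ u, nrm u ^ 2 = κ * (u ⬝ᵥ u)) (hκ : 0 ≤ κ) (hcc : 0 ≤ cc) (hv : 0 ≤ v)
    (hsd : ∀ U U', sdist U U' = sdist U' U)
    (hG : ∀ (g g' : X × ι → ℝ) (U U' : Finset (X × ι)), (∀ x ∉ U, g x = 0) → (∀ x ∉ U', g' x = 0) →
      |g ⬝ᵥ (gLam H ak (avgOp qk Tk) a ℓ (n : ℝ) (avgOp q T) Λ Λ' *ᵥ g')| ≤
        cc * nrm g * nrm g' * Real.exp (-(δ * sdist U U')))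
    (hG' : ∀ (g g' : X × ι → ℝ) (U U' : Finset (X × ι)), (∀ x ∉ U, g x = 0) → (∀ x ∉ U', g' x = 0) →
      |g ⬝ᵥ (gNext H ak (avgOp qk Tk) a ℓ (n : ℝ) (avgOp q T) *ᵥ g')| ≤
        cc * nrm g * nrm g' * Real.exp (-(δ * sdist U U')))
    (hVb : ∀ u u' : X × ι → ℝ,
      |u ⬝ᵥ (vOut ak (avgOp qk Tk) a ℓ (n : ℝ) (avgOp q T) Λ Λ' *ᵥ u')| ≤ v * nrm u * nrm u')
    (y y' : Λ) :
    |cLam H ak (avgOp qk Tk) a ℓ (n : ℝ) (avgOp q T) Λ y y' -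
        cLam H ak (avgOp qk Tk) a ℓ (n : ℝ) (avgOp q T) Finset.univ ⟨y.1, Finset.mem_univ _⟩
          ⟨y'.1, Finset.mem_univ _⟩| ≤
      max (2 * cc) (v * (κ * cc) ^ 2) * (κ * (c ^ 2 * nk)) *
        Real.exp (-(δ / 2 * (sdist (univ.filter fun r : X × ι => Blk (blk r.1) = Blk y.1.1)
            (univ.filter fun r : X × ι => Blk (blk r.1) = Blk y'.1.1) +
          sdist (univ.filter fun r : X × ι => Blk (blk r.1) = Blk y.1.1)
            (univ.filter fun r : X × ι => Blk (blk r.1) ∉ S') +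
          sdist (univ.filter fun r : X × ι => Blk (blk r.1) = Blk y'.1.1)
            (univ.filter fun r : X × ι => Blk (blk r.1) ∉ S')))) := by
  have hnpos : (0 : ℝ) < n := by exact_mod_cast hn
  have hRO := rowOrtho_avgOp Blk q T n hq hqc hcard hT
  have hB := blockCompatible_avgOp hq T hΛ hΛ'
  have hBU : BlockCompatible (avgOp q T) (Finset.univ : Finset (Y × ι)) (Finset.univ : Finset (Z × ι)) :=
    fun _ _ _ => by simp
  have h36 := rep36_of_kLam_posDef H (avgOp qk Tk) hak ha hℓ hnpos hRO hB hKΛ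
  have h36U := rep36_of_kLam_posDef H (avgOp qk Tk) hak ha hℓ hnpos hRO hBU hKU
  have hQk := avgOp_mul_transpose blk qk Tk c nk hqk hqkc hcardk hTk
  have hck : (0 : ℝ) ≤ c ^ 2 * nk := by positivity
  have hT' := fun p : Λ => tOp_row_sq_le hak ha.le hℓ.le hnpos hRO hQk hck Λ Λ' p
  have hR := avgOp_row_support_compl (blk := blk) (Blk := Blk) hqk Tk (S' := S') (Λ := Λ) hΛ
  have h310 := B4Ineq310Proof.ineq310 H ak (avgOp qk Tk) a ℓ (n : ℝ) (avgOp q T) Λ Λ' nrm sdist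
    (univ.filter fun r : X × ι => Blk (blk r.1) ∈ S') (univ.filter fun r : X × ι => Blk (blk r.1) ∉ S') κ cc δ v
    hKΛ.isUnit hKU.isUnit hB hR hn0 hn2 hκ hcc hv hsd hG hG' hVb
  have hc₀ : (0 : ℝ) ≤ max (2 * cc) (v * (κ * cc) ^ 2) := (by positivity : (0 : ℝ) ≤ 2 * cc).trans (le_max_left _ _)
  exact abs_deltaC_le (fun p : Λ => univ.filter fun r : X × ι => Blk (blk r.1) = Blk p.1.1) h36 h36U hB
    (fun p r hr => tOp_support_blockAvg hqk hq Tk T ak a ℓ (n : ℝ) Λ Λ' p r hr) (fun p => blockOf_subset_bkΛ hΛ p) hT'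
    hn2 hκ hc₀ h310 y y'

/-- **(1.18) FOR THE LATTICE BLOCK AVERAGING, AS PRINTED** (point form): under the block-diameter hypotheses relating
`|y−y′|` and `dist(y,Λ^c)` to the support distances (`hρS`, `hρL`, `δ ≥ 0`), `|δC^{(k)}_Λ(Ω,A;y,y′)| ≤ c₀κ(c²n_k)e^{3(δ/2)ρ}·
exp[−(δ/2)(|y−y′| + dist(y,Λ^c) + dist(y′,Λ^c))]` — *"|δC^{(k)}_Λ(Ω,A; x,x′)| ≤ c₀ exp(−δ₀(|x−x′| + dist(x,Λᶜ) +
dist(x′,Λᶜ))), x, x′ ∈ Λ. (1.18)"*. [cite: Balaban1983RegularityDecay, Prop. 2.3 of [1] (1.18) p.574, (3.10) p.589] -/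
theorem abs_deltaC_le_exp_blockAvg [Fintype X] [Fintype Y] [Fintype Z] [Fintype ι] [DecidableEq X]
    [DecidableEq Y] [DecidableEq Z] [DecidableEq ι] {blk : X → Y} {Blk : Y → Z} {qk : Y → X → ℝ}
    {q : Z → Y → ℝ} (Tk : Y → X → Matrix ι ι ℝ) (T : Z → Y → Matrix ι ι ℝ) {c : ℝ} {nk n : ℕ}
    (hqk : ∀ y x, blk x ≠ y → qk y x = 0) (hqkc : ∀ x, qk (blk x) x = c)
    (hcardk : ∀ y, (univ.filter fun x => blk x = y).card = nk) (hTk : ∀ x, Tk (blk x) x * (Tk (blk x) x)ᵀ = 1)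
    (hq : ∀ z y, Blk y ≠ z → q z y = 0) (hqc : ∀ y, q (Blk y) y = (n : ℝ)⁻¹)
    (hcard : ∀ z, (univ.filter fun y => Blk y = z).card = n) (hT : ∀ y, T (Blk y) y * (T (Blk y) y)ᵀ = 1)
    (hn : 0 < n) {S' : Finset Z} {Λ : Finset (Y × ι)} {Λ' : Finset (Z × ι)} (hΛ : ∀ p, p ∈ Λ ↔ Blk p.1 ∈ S')
    (hΛ' : ∀ r, r ∈ Λ' ↔ r.1 ∈ S') (H : Matrix (X × ι) (X × ι) ℝ) {ak a ℓ : ℝ} (hak : 0 < ak) (ha : 0 < a)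
    (hℓ : 0 < ℓ) (hKΛ : (kLam H ak (avgOp qk Tk) a ℓ (n : ℝ) (avgOp q T) Λ Λ').PosDef)
    (hKU : (kLam H ak (avgOp qk Tk) a ℓ (n : ℝ) (avgOp q T) Finset.univ Finset.univ).PosDef)
    {nrm : (X × ι → ℝ) → ℝ} {sdist : Finset (X × ι) → Finset (X × ι) → ℝ} {κ cc δ v : ℝ}
    (hn0 : ∀ u, 0 ≤ nrm u) (hn2 : ∀ u, nrm u ^ 2 = κ * (u ⬝ᵥ u)) (hκ : 0 ≤ κ) (hcc : 0 ≤ cc) (hv : 0 ≤ v)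
    (hsd : ∀ U U', sdist U U' = sdist U' U)
    (hG : ∀ (g g' : X × ι → ℝ) (U U' : Finset (X × ι)), (∀ x ∉ U, g x = 0) → (∀ x ∉ U', g' x = 0) →
      |g ⬝ᵥ (gLam H ak (avgOp qk Tk) a ℓ (n : ℝ) (avgOp q T) Λ Λ' *ᵥ g')| ≤
        cc * nrm g * nrm g' * Real.exp (-(δ * sdist U U')))
    (hG' : ∀ (g g' : X × ι → ℝ) (U U' : Finset (X × ι)), (∀ x ∉ U, g x = 0) → (∀ x ∉ U', g' x = 0) →
      |g ⬝ᵥ (gNext H ak (avgOp qk Tk) a ℓ (n : ℝ) (avgOp q T) *ᵥ g')| ≤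
        cc * nrm g * nrm g' * Real.exp (-(δ * sdist U U')))
    (hVb : ∀ u u' : X × ι → ℝ,
      |u ⬝ᵥ (vOut ak (avgOp qk Tk) a ℓ (n : ℝ) (avgOp q T) Λ Λ' *ᵥ u')| ≤ v * nrm u * nrm u')
    {udist : (Y × ι) → (Y × ι) → ℝ} {distLc : (Y × ι) → ℝ} {ρ : ℝ} (hδ : 0 ≤ δ)
    (hρS : ∀ p p' : Λ, udist p p' ≤ sdist (univ.filter fun r : X × ι => Blk (blk r.1) = Blk p.1.1)
      (univ.filter fun r : X × ι => Blk (blk r.1) = Blk p'.1.1) + ρ)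
    (hρL : ∀ p : Λ, distLc p ≤ sdist (univ.filter fun r : X × ι => Blk (blk r.1) = Blk p.1.1)
      (univ.filter fun r : X × ι => Blk (blk r.1) ∉ S') + ρ)
    (y y' : Λ) :
    |cLam H ak (avgOp qk Tk) a ℓ (n : ℝ) (avgOp q T) Λ y y' -
        cLam H ak (avgOp qk Tk) a ℓ (n : ℝ) (avgOp q T) Finset.univ ⟨y.1, Finset.mem_univ _⟩
          ⟨y'.1, Finset.mem_univ _⟩| ≤
      max (2 * cc) (v * (κ * cc) ^ 2) * (κ * (c ^ 2 * nk)) * Real.exp (3 * (δ / 2 * ρ)) *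
        Real.exp (-(δ / 2 * (udist y y' + distLc y + distLc y'))) := by
  have hnpos : (0 : ℝ) < n := by exact_mod_cast hn
  have hRO := rowOrtho_avgOp Blk q T n hq hqc hcard hT
  have hB := blockCompatible_avgOp hq T hΛ hΛ'
  have hBU : BlockCompatible (avgOp q T) (Finset.univ : Finset (Y × ι)) (Finset.univ : Finset (Z × ι)) :=
    fun _ _ _ => by simp
  have h36 := rep36_of_kLam_posDef H (avgOp qk Tk) hak ha hℓ hnpos hRO hB hKΛ
  have h36U := rep36_of_kLam_posDef H (avgOp qk Tk) hak ha hℓ hnpos hRO hBU hKU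
  have hQk := avgOp_mul_transpose blk qk Tk c nk hqk hqkc hcardk hTk
  have hck : (0 : ℝ) ≤ c ^ 2 * nk := by positivity
  have hT' := fun p : Λ => tOp_row_sq_le hak ha.le hℓ.le hnpos hRO hQk hck Λ Λ' p
  have hR := avgOp_row_support_compl (blk := blk) (Blk := Blk) hqk Tk (S' := S') (Λ := Λ) hΛ
  have h310 := B4Ineq310Proof.ineq310 H ak (avgOp qk Tk) a ℓ (n : ℝ) (avgOp q T) Λ Λ' nrm sdist
    (univ.filter fun r : X × ι => Blk (blk r.1) ∈ S') (univ.filter fun r : X × ι => Blk (blk r.1) ∉ S') κ cc δ v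
    hKΛ.isUnit hKU.isUnit hB hR hn0 hn2 hκ hcc hv hsd hG hG' hVb
  have hc₀ : (0 : ℝ) ≤ max (2 * cc) (v * (κ * cc) ^ 2) := (by positivity : (0 : ℝ) ≤ 2 * cc).trans (le_max_left _ _)
  exact abs_deltaC_le_exp (fun p : Λ => univ.filter fun r : X × ι => Blk (blk r.1) = Blk p.1.1) h36 h36U hB
    (fun p r hr => tOp_support_blockAvg hqk hq Tk T ak a ℓ (n : ℝ) Λ Λ' p r hr) (fun p => blockOf_subset_bkΛ hΛ p) hT'
    hn2 hκ hck hc₀ h310 (by positivity) hρS hρL y y'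

/-- **(1.20) FOR THE LATTICE BLOCK AVERAGING, support form**: two background operators `H` (for `Ω`, extended
block-diagonally) and `H₀` (for `Ω₀ ⊃ Ω`) on the common site set, the same block averaging, both two-scale forms (3.5)
positive definite, and the second member of Corollary 2.3 (2.30) for `G_k(Ω,Λ,A) − G_k(Ω₀,Λ,A)` (`hGd`, *"with the
additional factor e^{−δ₀(dist(supp f,Ωᶜ) + dist(supp f′,Ωᶜ))}"*, `bOc` ↤ `B^k(Ω^{(k)c})`) ⇒ `|δC^{(k)}_Λ(Ω,Ω₀,A;y,y′)| ≤
cκ(c²n_k)·exp[−δ(dist(S_y,S_{y′}) + dist(S_y,bOc) + dist(S_{y′},bOc))]` — *"|δC^{(k)}_Λ(Ω,Ω₀,A; x,x′)| ≤ c₀ exp(−δ₀(|x−x′| +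
dist(x,Ω^{(k)c}) + dist(x′,Ω^{(k)c}))) (1.20)"* in support form. [cite: Balaban1983RegularityDecay, Prop. 2.3 of [1] (1.19)–(1.20) p.574, (3.8) p.588] -/
theorem abs_deltaC_region_le_blockAvg [Fintype X] [Fintype Y] [Fintype Z] [Fintype ι] [DecidableEq X]
    [DecidableEq Y] [DecidableEq Z] [DecidableEq ι] {blk : X → Y} {Blk : Y → Z} {qk : Y → X → ℝ}
    {q : Z → Y → ℝ} (Tk : Y → X → Matrix ι ι ℝ) (T : Z → Y → Matrix ι ι ℝ) {c : ℝ} {nk n : ℕ}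
    (hqk : ∀ y x, blk x ≠ y → qk y x = 0) (hqkc : ∀ x, qk (blk x) x = c)
    (hcardk : ∀ y, (univ.filter fun x => blk x = y).card = nk) (hTk : ∀ x, Tk (blk x) x * (Tk (blk x) x)ᵀ = 1)
    (hq : ∀ z y, Blk y ≠ z → q z y = 0) (hqc : ∀ y, q (Blk y) y = (n : ℝ)⁻¹)
    (hcard : ∀ z, (univ.filter fun y => Blk y = z).card = n) (hT : ∀ y, T (Blk y) y * (T (Blk y) y)ᵀ = 1)
    (hn : 0 < n) {S' : Finset Z} {Λ : Finset (Y × ι)} {Λ' : Finset (Z × ι)} (hΛ : ∀ p, p ∈ Λ ↔ Blk p.1 ∈ S')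
    (hΛ' : ∀ r, r ∈ Λ' ↔ r.1 ∈ S') (H H₀ : Matrix (X × ι) (X × ι) ℝ) {ak a ℓ : ℝ} (hak : 0 < ak) (ha : 0 < a)
    (hℓ : 0 < ℓ) (hKΛ : (kLam H ak (avgOp qk Tk) a ℓ (n : ℝ) (avgOp q T) Λ Λ').PosDef)
    (hKΛ₀ : (kLam H₀ ak (avgOp qk Tk) a ℓ (n : ℝ) (avgOp q T) Λ Λ').PosDef)
    {nrm : (X × ι → ℝ) → ℝ} {sdist : Finset (X × ι) → Finset (X × ι) → ℝ} {bOc : Finset (X × ι)} {κ cc δ : ℝ}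
    (hn2 : ∀ u, nrm u ^ 2 = κ * (u ⬝ᵥ u)) (hκ : 0 ≤ κ) (hcc : 0 ≤ cc)
    (hGd : ∀ (g g' : X × ι → ℝ) (U U' : Finset (X × ι)), (∀ x ∉ U, g x = 0) → (∀ x ∉ U', g' x = 0) →
      |g ⬝ᵥ ((gLam H ak (avgOp qk Tk) a ℓ (n : ℝ) (avgOp q T) Λ Λ' -
          gLam H₀ ak (avgOp qk Tk) a ℓ (n : ℝ) (avgOp q T) Λ Λ') *ᵥ g')| ≤
        cc * nrm g * nrm g' * Real.exp (-(δ * (sdist U U' + sdist U bOc + sdist U' bOc))))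
    (y y' : Λ) :
    |cLam H ak (avgOp qk Tk) a ℓ (n : ℝ) (avgOp q T) Λ y y' -
        cLam H₀ ak (avgOp qk Tk) a ℓ (n : ℝ) (avgOp q T) Λ y y'| ≤
      cc * (κ * (c ^ 2 * nk)) *
        Real.exp (-(δ * (sdist (univ.filter fun r : X × ι => Blk (blk r.1) = Blk y.1.1)
            (univ.filter fun r : X × ι => Blk (blk r.1) = Blk y'.1.1) +
          sdist (univ.filter fun r : X × ι => Blk (blk r.1) = Blk y.1.1) bOc +
          sdist (univ.filter fun r : X × ι => Blk (blk r.1) = Blk y'.1.1) bOc))) := by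
  have hnpos : (0 : ℝ) < n := by exact_mod_cast hn
  have hRO := rowOrtho_avgOp Blk q T n hq hqc hcard hT
  have hB := blockCompatible_avgOp hq T hΛ hΛ'
  have h36 := rep36_of_kLam_posDef H (avgOp qk Tk) hak ha hℓ hnpos hRO hB hKΛ
  have h36₀ := rep36_of_kLam_posDef H₀ (avgOp qk Tk) hak ha hℓ hnpos hRO hB hKΛ₀
  have hQk := avgOp_mul_transpose blk qk Tk c nk hqk hqkc hcardk hTk
  have hck : (0 : ℝ) ≤ c ^ 2 * nk := by positivity
  have hT' := fun p : Λ => tOp_row_sq_le hak ha.le hℓ.le hnpos hRO hQk hck Λ Λ' p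
  exact abs_deltaC_region_le (fun p : Λ => univ.filter fun r : X × ι => Blk (blk r.1) = Blk p.1.1) h36 h36₀
    (fun p r hr => tOp_support_blockAvg hqk hq Tk T ak a ℓ (n : ℝ) Λ Λ' p r hr) hT' hn2 hκ hcc hGd y y'

/-! ## §3. (1.15) for the block averaging -/

/-- **(1.15) FOR THE LATTICE BLOCK AVERAGING** *"γ₀I ≤ Δ^{(k)}(Ω,A) + aL^{−2}P(A) ≤ γ₁I"* on `L²(Ω^{(k)})`, with the
explicit constants `γ₀ = (c′c²n_k + a_k⁻¹)⁻¹`, `γ₁ = a_k + aL^{−2}`: block-averaging `Q_k(A)` (weights `c`, `n_k` sites per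
unit block), `Q(A)` (weights `n⁻¹ = L^{−d}`), orthogonal transporters, `a_k, a, L^{−2} > 0`, the form (3.5) at `Λ = Ω^{(k)}`
(that of `G^η_{k+1}(Ω,A)`) positive definite ((1.8)) and its `L²` bound `⟨g, G^η_{k+1}(Ω,A)g⟩ ≤ c′|g|²` (`hG0`, the
(2.28)/(2.30)-shape INPUT); everything else — (3.6), `RowOrtho`, `P` a projection, the Gram bound of the (3.8) functions,
positivity of the form of `G_k(Ω,A)` — is discharged. [cite: Balaban1983RegularityDecay, Prop. 2.3 of [1] (1.15) p.574, (3.6) p.588] -/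
theorem form115_blockAvg [Fintype X] [Fintype Y] [Fintype Z] [Fintype ι] [DecidableEq X] [DecidableEq Y]
    [DecidableEq Z] [DecidableEq ι] {blk : X → Y} {Blk : Y → Z} {qk : Y → X → ℝ} {q : Z → Y → ℝ}
    (Tk : Y → X → Matrix ι ι ℝ) (T : Z → Y → Matrix ι ι ℝ) {c : ℝ} {nk n : ℕ}
    (hqk : ∀ y x, blk x ≠ y → qk y x = 0) (hqkc : ∀ x, qk (blk x) x = c)
    (hcardk : ∀ y, (univ.filter fun x => blk x = y).card = nk) (hTk : ∀ x, Tk (blk x) x * (Tk (blk x) x)ᵀ = 1)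
    (hq : ∀ z y, Blk y ≠ z → q z y = 0) (hqc : ∀ y, q (Blk y) y = (n : ℝ)⁻¹)
    (hcard : ∀ z, (univ.filter fun y => Blk y = z).card = n) (hT : ∀ y, T (Blk y) y * (T (Blk y) y)ᵀ = 1)
    (hn : 0 < n) (H : Matrix (X × ι) (X × ι) ℝ) {ak a ℓ : ℝ} (hak : 0 < ak) (ha : 0 < a) (hℓ : 0 < ℓ)
    (hKU : (kLam H ak (avgOp qk Tk) a ℓ (n : ℝ) (avgOp q T) Finset.univ Finset.univ).PosDef) {c' : ℝ}
    (hG0 : ∀ g : X × ι → ℝ, g ⬝ᵥ (gNext H ak (avgOp qk Tk) a ℓ (n : ℝ) (avgOp q T) *ᵥ g) ≤ c' * (g ⬝ᵥ g))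
    (hc' : 0 ≤ c') (u : Y × ι → ℝ) :
    (c' * (c ^ 2 * nk) + 1 / ak)⁻¹ * (u ⬝ᵥ u) ≤
        u ⬝ᵥ ((deltaK H ak (avgOp qk Tk) + (a * ℓ) • pOp (n : ℝ) (avgOp q T)) *ᵥ u) ∧
      u ⬝ᵥ ((deltaK H ak (avgOp qk Tk) + (a * ℓ) • pOp (n : ℝ) (avgOp q T)) *ᵥ u) ≤ (ak + a * ℓ) * (u ⬝ᵥ u) := by
  have hnpos : (0 : ℝ) < n := by exact_mod_cast hn
  have hRO := rowOrtho_avgOp Blk q T n hq hqc hcard hT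
  have hBU : BlockCompatible (avgOp q T) (Finset.univ : Finset (Y × ι)) (Finset.univ : Finset (Z × ι)) :=
    fun _ _ _ => by simp
  have h36U := rep36_of_kLam_posDef H (avgOp qk Tk) hak ha hℓ hnpos hRO hBU hKU
  have hK := kForm_posDef_of_kLam_posDef H (avgOp qk Tk) hak ha hℓ hnpos hRO hBU hKU
  have hPle := dotProduct_pOp_mulVec_le hRO hnpos.ne'
  have hPnn := dotProduct_pOp_mulVec_nonneg hnpos.le (avgOp q T)
  have hQk := avgOp_mul_transpose blk qk Tk c nk hqk hqkc hcardk hTk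
  have hck : (0 : ℝ) ≤ c ^ 2 * nk := by positivity
  have hTT := tOp_gram_form_le hak ha.le hℓ.le hnpos hRO hQk hck
    (Finset.univ : Finset (Y × ι)) (Finset.univ : Finset (Z × ι))
  exact ⟨form115_lower h36U hKU hG0 hc' hTT hck hPnn hPle hak ha.le hℓ.le u,
    form115_upper H (avgOp qk Tk) (avgOp q T) hK (by positivity) hPle u⟩

/-! ## §4. (v1.1) (1.16), (1.18) for the block averaging and EVERY `Λ`, by the combined §3 ∧ §5 route
(`B4Prop23Sect5Route.prop23_116_118_of_cor23_rep36`) — modulo Corollary 2.3-type bounds for the ONE-scale propagators -/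

/-- The plain square norm of a row of `Q_k(A)` is `c²n_k` (from `Q_kQ_kᵀ = c²n_k·1`). [cite: Balaban1983RegularityDecay, (1.4)–(1.5) p.572, p.588] -/
theorem avgOp_row_sq_le [Fintype X] [Fintype Y] [Fintype ι] [DecidableEq Y] [DecidableEq ι] {blk : X → Y}
    {qk : Y → X → ℝ} (Tk : Y → X → Matrix ι ι ℝ) {c : ℝ} {nk : ℕ} (hqk : ∀ y x, blk x ≠ y → qk y x = 0)
    (hqkc : ∀ x, qk (blk x) x = c) (hcardk : ∀ y, (univ.filter fun x => blk x = y).card = nk)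
    (hTk : ∀ x, Tk (blk x) x * (Tk (blk x) x)ᵀ = 1) (p : Y × ι) :
    (fun r => avgOp qk Tk p r) ⬝ᵥ (fun r => avgOp qk Tk p r) ≤ c ^ 2 * nk := by
  have hQk := avgOp_mul_transpose blk qk Tk c nk hqk hqkc hcardk hTk
  have h : (fun r => avgOp qk Tk p r) ⬝ᵥ (fun r => avgOp qk Tk p r) = (avgOp qk Tk * (avgOp qk Tk)ᵀ) p p := by
    simp only [Matrix.mul_apply, Matrix.transpose_apply, dotProduct]
  rw [h, hQk, Matrix.smul_apply, Matrix.one_apply_eq, smul_eq_mul, mul_one]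

/-- **(1.16) and (1.17)–(1.18) of Proposition I.2.3 FOR THE LATTICE BLOCK AVERAGING, for EVERY `Λ ⊆ Ω^{(k)}` and every
gauge field**, by the combined route `B4Prop23Sect5Route.prop23_116_118_of_cor23_rep36` (§3-route lower bound (1.15) ⇒
(5.3); Corollary 2.3 ⇒ (5.4); the kernel-proved Sect. 5 Theorem), with EVERY structural hypothesis discharged for the
block-averaging matrices `Q_k(A) = avgOp qk Tk`, `Q(A) = avgOp q T` (block weights `c`, `n⁻¹ = L^{−d}`; orthogonal
transporters): (3.6) at `Λ = Ω^{(k)}` (`rep36_of_kLam_posDef`), the Gram bound of the (3.8) functions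
(`tOp_gram_form_le`), `0 ≤ P ≤ 1` and `|P(y,y′)| ≤ 1` (`dotProduct_pOp_mulVec_nonneg/_le`, `abs_pOp_le_one`), supports
and norms of the rows of `Q_k` (`avgOp_apply_ne_zero`, `avgOp_row_sq_le`).  LEFT AS EXPLICIT BINDERS, exactly the
analytic inputs: symmetry of the form matrix `H` (`hH`), positivity (1.8) of the form (3.5) at `Λ = Ω^{(k)}` (`hKU`), the
`L²` bound `⟨g, G^η_{k+1}(Ω,A)g⟩ ≤ c′|g|²` (`hG0`) and the Corollary 2.3 (2.30) kernel decay of `G_k(Ω,A)` (`hG`) — both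
for ONE-scale propagators, as printed — a lattice-sum profile `K` of the unit lattice with its pseudo-distance `ρ`
(`hSB`; for `Ω^{(k)} ⊂ ℤ^d`: `B4Sect5Proof.idxSum_le`), and the block geometry `ρ(p,p′) ≤ dist(B^k(y),B^k(y′)) + r`,
`P(p,p′) ≠ 0 ⇒ ρ(p,p′) ≤ r`.  Constants: `γ₀ = (c′c²n_k + a_k⁻¹)⁻¹`, `c₀ = (a_k²c_Gκc²n_k + aL^{−2} + a_k)e^{δr}`,
`δ₀ = δ`, then `c₁ = cSt K γ₀ c₀ δ`, `δ₁ = dSt K γ₀ c₀ δ` of `B4Sect5Torus`.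
[cite: Balaban1983RegularityDecay, Prop. 2.3 of [1] (1.15)–(1.18) p.574, pp.588–589, (5.1)–(5.4) p.593, Sect. 5 Theorem p.594] -/
theorem prop23_116_118_blockAvg_sect5 [Fintype X] [Fintype Y] [Fintype Z] [Fintype ι] [DecidableEq X]
    [DecidableEq Y] [DecidableEq Z] [DecidableEq ι] {blk : X → Y} {Blk : Y → Z} {qk : Y → X → ℝ}
    {q : Z → Y → ℝ} (Tk : Y → X → Matrix ι ι ℝ) (T : Z → Y → Matrix ι ι ℝ) {c : ℝ} {nk n : ℕ}
    (hqk : ∀ y x, blk x ≠ y → qk y x = 0) (hqkc : ∀ x, qk (blk x) x = c)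
    (hcardk : ∀ y, (univ.filter fun x => blk x = y).card = nk) (hTk : ∀ x, Tk (blk x) x * (Tk (blk x) x)ᵀ = 1)
    (hq : ∀ z y, Blk y ≠ z → q z y = 0) (hqc : ∀ y, q (Blk y) y = (n : ℝ)⁻¹)
    (hcard : ∀ z, (univ.filter fun y => Blk y = z).card = n) (hT : ∀ y, T (Blk y) y * (T (Blk y) y)ᵀ = 1)
    (hn : 0 < n) {H : Matrix (X × ι) (X × ι) ℝ} (hH : H.IsSymm) {ak a ℓ : ℝ} (hak : 0 < ak) (ha : 0 < a)
    (hℓ : 0 < ℓ) (hKU : (kLam H ak (avgOp qk Tk) a ℓ (n : ℝ) (avgOp q T) Finset.univ Finset.univ).PosDef)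
    {c' : ℝ}
    (hG0 : ∀ g : X × ι → ℝ, g ⬝ᵥ (gNext H ak (avgOp qk Tk) a ℓ (n : ℝ) (avgOp q T) *ᵥ g) ≤ c' * (g ⬝ᵥ g))
    (hc' : 0 ≤ c') {nrm : (X × ι → ℝ) → ℝ} {sdist : Finset (X × ι) → Finset (X × ι) → ℝ} {κ cG δ r : ℝ}
    (hn2 : ∀ u, nrm u ^ 2 = κ * (u ⬝ᵥ u)) (hκ : 0 ≤ κ) (hcG : 0 ≤ cG)
    (hG : ∀ (g g' : X × ι → ℝ) (U U' : Finset (X × ι)), (∀ x ∉ U, g x = 0) → (∀ x ∉ U', g' x = 0) →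
      |g ⬝ᵥ (gk H ak (avgOp qk Tk) *ᵥ g')| ≤ cG * nrm g * nrm g' * Real.exp (-(δ * sdist U U')))
    {K : ℝ → ℝ} (hK : ∀ t, 0 < t → 0 ≤ K t) {ρ : Y × ι → Y × ι → ℝ} (hρ : B4Sect5Torus.IsPseudoDist ρ)
    (hSB : B4Sect5Torus.SumBound ρ K) (hδ : 0 < δ) (hr : 0 ≤ r)
    (hρS : ∀ p p' : Y × ι, ρ p p' ≤
      sdist (univ.filter fun x : X × ι => blk x.1 = p.1) (univ.filter fun x : X × ι => blk x.1 = p'.1) + r)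
    (hρP : ∀ p p' : Y × ι, pOp (n : ℝ) (avgOp q T) p p' ≠ 0 → ρ p p' ≤ r) (Λ : Finset (Y × ι)) :
    (∀ p p' : Λ, |cLam H ak (avgOp qk Tk) a ℓ (n : ℝ) (avgOp q T) Λ p p'| ≤
        B4Sect5Torus.cSt K (c' * (c ^ 2 * nk) + 1 / ak)⁻¹
            ((ak ^ 2 * (cG * (κ * (c ^ 2 * nk))) + a * ℓ + ak) * Real.exp (δ * r)) δ *
          Real.exp (-(B4Sect5Torus.dSt K (c' * (c ^ 2 * nk) + 1 / ak)⁻¹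
            ((ak ^ 2 * (cG * (κ * (c ^ 2 * nk))) + a * ℓ + ak) * Real.exp (δ * r)) δ * ρ p p'))) ∧
    (∀ β : Λ → ℝ, (∀ p, 0 ≤ β p) → (∀ (p : Λ) (z : Y × ι), z ∉ Λ → β p ≤ ρ p z) →
      ∀ p p' : Λ, |cLam H ak (avgOp qk Tk) a ℓ (n : ℝ) (avgOp q T) Λ p p' -
          (deltaK H ak (avgOp qk Tk) + (a * ℓ) • pOp (n : ℝ) (avgOp q T))⁻¹ p p'| ≤
        B4Sect5Torus.cSt K (c' * (c ^ 2 * nk) + 1 / ak)⁻¹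
            ((ak ^ 2 * (cG * (κ * (c ^ 2 * nk))) + a * ℓ + ak) * Real.exp (δ * r)) δ *
          Real.exp (-(B4Sect5Torus.dSt K (c' * (c ^ 2 * nk) + 1 / ak)⁻¹
            ((ak ^ 2 * (cG * (κ * (c ^ 2 * nk))) + a * ℓ + ak) * Real.exp (δ * r)) δ *
              (ρ p p' + β p + β p')))) := by
  have hnpos : (0 : ℝ) < n := by exact_mod_cast hn
  have hRO := rowOrtho_avgOp Blk q T n hq hqc hcard hT
  have hBU : BlockCompatible (avgOp q T) (Finset.univ : Finset (Y × ι)) (Finset.univ : Finset (Z × ι)) :=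
    fun _ _ _ => by simp
  have h36U := rep36_of_kLam_posDef H (avgOp qk Tk) hak ha hℓ hnpos hRO hBU hKU
  have hPle := dotProduct_pOp_mulVec_le hRO hnpos.ne'
  have hPnn := dotProduct_pOp_mulVec_nonneg hnpos.le (avgOp q T)
  have hQk := avgOp_mul_transpose blk qk Tk c nk hqk hqkc hcardk hTk
  have hck : (0 : ℝ) ≤ c ^ 2 * nk := by positivity
  have hTT := tOp_gram_form_le hak ha.le hℓ.le hnpos hRO hQk hck
    (Finset.univ : Finset (Y × ι)) (Finset.univ : Finset (Z × ι))
  have hP1 := abs_pOp_le_one hRO hnpos.ne'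
  have hS : ∀ (p : Y × ι) (x : X × ι), x ∉ (univ.filter fun x : X × ι => blk x.1 = p.1) →
      avgOp qk Tk p x = 0 := by
    intro p x hx
    by_contra h
    exact hx (Finset.mem_filter.mpr ⟨Finset.mem_univ _, avgOp_apply_ne_zero hqk Tk h⟩)
  have hT' := avgOp_row_sq_le Tk hqk hqkc hcardk hTk
  exact B4Prop23Sect5Route.prop23_116_118_of_cor23_rep36 hK hρ hSB
    (fun p : Y × ι => univ.filter fun x : X × ι => blk x.1 = p.1) hH h36U hKU hG0 hc' hTT hck hPnn hPle hS
    hT' hn2 hκ hcG hck hak ha.le hℓ.le hG hδ hr hρS hρP hP1 Λ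

/-! ## §5. (v1.2) (1.19)–(1.20) for the block averaging and EVERY `Λ`, by the §5 route
(`B4Prop23Sect5Route.prop23_120_of_cor23_rep36`) — modulo one-scale Corollary 2.3 / Theorem (1.11)–(1.12) inputs -/

/-- **(1.19)–(1.20) of Proposition I.2.3 FOR THE LATTICE BLOCK AVERAGING, for EVERY `Λ ⊆ Ω^{(k)}`, every gauge field
and two regions `Ω ⊂ Ω₀`** — *"for Λ ⊂ Ω^{(k)} ⊂ Ω₀^{(k)} and δC^{(k)}_Λ(Ω,Ω₀,A) = C^{(k)}_Λ(Ω,A) − C^{(k)}_Λ(Ω₀,A) we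
have |δC^{(k)}_Λ(Ω,Ω₀,A;x,x′)| ≤ c₀exp(−δ₀|x−x′| − δ₀dist(x,Ω^{(k)c}) − δ₀dist(x′,Ω^{(k)c}))"* — by the §5 route
`B4Prop23Sect5Route.prop23_120_of_cor23_rep36` with EVERY structural hypothesis discharged for the block-averaging
matrices `Q_k(A) = avgOp qk Tk`, `Q(A) = avgOp q T` exactly as in `prop23_116_118_blockAvg_sect5` ((3.6) at
`Λ = Ω^{(k)}` for both form matrices by `rep36_of_kLam_posDef`, `tOp_gram_form_le`, `dotProduct_pOp_mulVec_nonneg/_le`,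
`abs_pOp_le_one`, `avgOp_apply_ne_zero`, `avgOp_row_sq_le`).  The two regions enter through two form matrices on the
common site set: `H` (of `Ω`; inside `Ω₀` e.g. Neumann-decoupled along `∂Ω`) and `H₀` (of `Ω₀`).  LEFT AS EXPLICIT
BINDERS, exactly the analytic inputs: symmetry (`hH`, `hH₀`), positivity (1.8) of the forms (3.5) at `Λ = Ω^{(k)}`
(`hKU`, `hKU₀`), the `L²` bounds `⟨g, G^η_{k+1}g⟩ ≤ c′|g|²` (`hG0`, `hG0₀`), Corollary 2.3 (2.30) for `G_k(Ω,A)` and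
`G_k(Ω₀,A)` (`hG`, `hGz`), the Theorem (1.11)–(1.12) three-distance decay of `δG_k(Ω,Ω₀,A)` (`hGd`; `sdc U` = distance
of `U` to `Ω^c`), a lattice-sum profile `K` (`hSB`), the block geometry (`hρS`, `hρP`) and an admissible boundary weight
`ω` (`0 ≤ ω`, `ρ`-Lipschitz, `ω(p) ≤ sdc B^k(y(p)) + r`; on the lattice `dist(·,Ω^{(k)c})`).  Constants:
`γ₀ = (c′c²n_k + a_k⁻¹)⁻¹`, `c₀ = (a_k²c_Gκc²n_k + aL^{−2} + a_k)e^{3δr}`, `δ₀ = δ`, then `c₁ = cSt K γ₀ c₀ δ`,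
`δ₁ = dSt K γ₀ c₀ δ` of `B4Sect5Torus`.
[cite: Balaban1983RegularityDecay, Prop. 2.3 of [1] (1.19)–(1.20) p.574, pp.588–589, (5.3)–(5.5) pp.593–594, Sect. 5 Theorem (5.9)–(5.10) p.594] -/
theorem prop23_120_blockAvg_sect5 [Fintype X] [Fintype Y] [Fintype Z] [Fintype ι] [DecidableEq X]
    [DecidableEq Y] [DecidableEq Z] [DecidableEq ι] {blk : X → Y} {Blk : Y → Z} {qk : Y → X → ℝ}
    {q : Z → Y → ℝ} (Tk : Y → X → Matrix ι ι ℝ) (T : Z → Y → Matrix ι ι ℝ) {c : ℝ} {nk n : ℕ}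
    (hqk : ∀ y x, blk x ≠ y → qk y x = 0) (hqkc : ∀ x, qk (blk x) x = c)
    (hcardk : ∀ y, (univ.filter fun x => blk x = y).card = nk) (hTk : ∀ x, Tk (blk x) x * (Tk (blk x) x)ᵀ = 1)
    (hq : ∀ z y, Blk y ≠ z → q z y = 0) (hqc : ∀ y, q (Blk y) y = (n : ℝ)⁻¹)
    (hcard : ∀ z, (univ.filter fun y => Blk y = z).card = n) (hT : ∀ y, T (Blk y) y * (T (Blk y) y)ᵀ = 1)
    (hn : 0 < n) {H H₀ : Matrix (X × ι) (X × ι) ℝ} (hH : H.IsSymm) (hH₀ : H₀.IsSymm) {ak a ℓ : ℝ}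
    (hak : 0 < ak) (ha : 0 < a) (hℓ : 0 < ℓ)
    (hKU : (kLam H ak (avgOp qk Tk) a ℓ (n : ℝ) (avgOp q T) Finset.univ Finset.univ).PosDef)
    (hKU₀ : (kLam H₀ ak (avgOp qk Tk) a ℓ (n : ℝ) (avgOp q T) Finset.univ Finset.univ).PosDef)
    {c' : ℝ}
    (hG0 : ∀ g : X × ι → ℝ, g ⬝ᵥ (gNext H ak (avgOp qk Tk) a ℓ (n : ℝ) (avgOp q T) *ᵥ g) ≤ c' * (g ⬝ᵥ g))
    (hG0₀ : ∀ g : X × ι → ℝ, g ⬝ᵥ (gNext H₀ ak (avgOp qk Tk) a ℓ (n : ℝ) (avgOp q T) *ᵥ g) ≤ c' * (g ⬝ᵥ g))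
    (hc' : 0 ≤ c') {nrm : (X × ι → ℝ) → ℝ} {sdist : Finset (X × ι) → Finset (X × ι) → ℝ}
    {sdc : Finset (X × ι) → ℝ} {κ cG δ r : ℝ}
    (hn2 : ∀ u, nrm u ^ 2 = κ * (u ⬝ᵥ u)) (hκ : 0 ≤ κ) (hcG : 0 ≤ cG)
    (hG : ∀ (g g' : X × ι → ℝ) (U U' : Finset (X × ι)), (∀ x ∉ U, g x = 0) → (∀ x ∉ U', g' x = 0) →
      |g ⬝ᵥ (gk H ak (avgOp qk Tk) *ᵥ g')| ≤ cG * nrm g * nrm g' * Real.exp (-(δ * sdist U U')))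
    (hGz : ∀ (g g' : X × ι → ℝ) (U U' : Finset (X × ι)), (∀ x ∉ U, g x = 0) → (∀ x ∉ U', g' x = 0) →
      |g ⬝ᵥ (gk H₀ ak (avgOp qk Tk) *ᵥ g')| ≤ cG * nrm g * nrm g' * Real.exp (-(δ * sdist U U')))
    (hGd : ∀ (g g' : X × ι → ℝ) (U U' : Finset (X × ι)), (∀ x ∉ U, g x = 0) → (∀ x ∉ U', g' x = 0) →
      |g ⬝ᵥ ((gk H ak (avgOp qk Tk) - gk H₀ ak (avgOp qk Tk)) *ᵥ g')| ≤
        cG * nrm g * nrm g' * Real.exp (-(δ * (sdist U U' + sdc U + sdc U'))))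
    {K : ℝ → ℝ} (hK : ∀ t, 0 < t → 0 ≤ K t) {ρ : Y × ι → Y × ι → ℝ} (hρ : B4Sect5Torus.IsPseudoDist ρ)
    (hSB : B4Sect5Torus.SumBound ρ K) (hδ : 0 < δ) (hr : 0 ≤ r)
    (hρS : ∀ p p' : Y × ι, ρ p p' ≤
      sdist (univ.filter fun x : X × ι => blk x.1 = p.1) (univ.filter fun x : X × ι => blk x.1 = p'.1) + r)
    (hρP : ∀ p p' : Y × ι, pOp (n : ℝ) (avgOp q T) p p' ≠ 0 → ρ p p' ≤ r)
    {ω : Y × ι → ℝ} (hω0 : ∀ p, 0 ≤ ω p) (hωρ : ∀ p p', ω p ≤ ρ p p' + ω p')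
    (hωS : ∀ p : Y × ι, ω p ≤ sdc (univ.filter fun x : X × ι => blk x.1 = p.1) + r)
    (Λ : Finset (Y × ι)) (p p' : Λ) :
    |cLam H ak (avgOp qk Tk) a ℓ (n : ℝ) (avgOp q T) Λ p p' - cLam H₀ ak (avgOp qk Tk) a ℓ (n : ℝ) (avgOp q T) Λ p p'|
      ≤ B4Sect5Torus.cSt K (c' * (c ^ 2 * nk) + 1 / ak)⁻¹
            ((ak ^ 2 * (cG * (κ * (c ^ 2 * nk))) + a * ℓ + ak) * Real.exp (3 * (δ * r))) δ *
          Real.exp (-(B4Sect5Torus.dSt K (c' * (c ^ 2 * nk) + 1 / ak)⁻¹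
            ((ak ^ 2 * (cG * (κ * (c ^ 2 * nk))) + a * ℓ + ak) * Real.exp (3 * (δ * r))) δ *
              (ρ p p' + ω p + ω p'))) := by
  have hnpos : (0 : ℝ) < n := by exact_mod_cast hn
  have hRO := rowOrtho_avgOp Blk q T n hq hqc hcard hT
  have hBU : BlockCompatible (avgOp q T) (Finset.univ : Finset (Y × ι)) (Finset.univ : Finset (Z × ι)) :=
    fun _ _ _ => by simp
  have h36U := rep36_of_kLam_posDef H (avgOp qk Tk) hak ha hℓ hnpos hRO hBU hKU
  have h36U₀ := rep36_of_kLam_posDef H₀ (avgOp qk Tk) hak ha hℓ hnpos hRO hBU hKU₀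
  have hPle := dotProduct_pOp_mulVec_le hRO hnpos.ne'
  have hPnn := dotProduct_pOp_mulVec_nonneg hnpos.le (avgOp q T)
  have hQk := avgOp_mul_transpose blk qk Tk c nk hqk hqkc hcardk hTk
  have hck : (0 : ℝ) ≤ c ^ 2 * nk := by positivity
  have hTT := tOp_gram_form_le hak ha.le hℓ.le hnpos hRO hQk hck
    (Finset.univ : Finset (Y × ι)) (Finset.univ : Finset (Z × ι))
  have hP1 := abs_pOp_le_one hRO hnpos.ne'
  have hS : ∀ (p : Y × ι) (x : X × ι), x ∉ (univ.filter fun x : X × ι => blk x.1 = p.1) →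
      avgOp qk Tk p x = 0 := by
    intro p x hx
    by_contra h
    exact hx (Finset.mem_filter.mpr ⟨Finset.mem_univ _, avgOp_apply_ne_zero hqk Tk h⟩)
  have hT' := avgOp_row_sq_le Tk hqk hqkc hcardk hTk
  exact B4Prop23Sect5Route.prop23_120_of_cor23_rep36 hK hρ hSB
    (fun p : Y × ι => univ.filter fun x : X × ι => blk x.1 = p.1) hH hH₀ h36U h36U₀ hKU hKU₀ hG0 hG0₀ hc' hTT hck
    hPnn hPle hS hT' hn2 hκ hcG hck hak ha.le hℓ.le hG hGz hGd hδ hr hρS hρP hP1 hω0 hωρ hωS Λ p p'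

end Literature.MathematicalPhysics.QuantumFieldTheory.Balaban1983to89.B4Prop23BlockAvg
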